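import Summits.QuantumFields.YangMills.Theorems.SwapVirialDeficitSectorLaplaceEndCoreAssembly
import HarnessLib

/-!
# `stub_core_end` OF SKELETON ➎ FROM THE MATCHED COMPARISON ON THE GAUSSIAN CORE `G♭ = ({end window} ∖ RgCap) ∩ {|u|² ≤ 1 + x₀²}`
# (free-hands support of ⟨stmt-QuantumFields-24197⟩ `SwapVirialDeficit.SwapGluedStiffness`; LEAD g99 self-correction 2026-08-31 22:22Z)

✓`…EndCoreSplit` ∕ ✓`…EndCoreAssembly` split the end core `{end window} ∖ RgCap` as `G ∪ T` with the Gaussian HALF `G = {end window} ∩ {|u|² ≤ 1+x₀²}`.  That `G`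
OVER-COVERS: it contains the part of the capped B-tube `RgCap` with `|u|² ≤ 1 + x₀²`, a neighbourhood of the flat B-stratum, whose weight against the bulk's
Morse–Bott main term is a cross-stratum determinant ratio — not absorbable with polynomial thresholds (LEAD memo10a).  The USEFUL split keeps the excision:
the GAUSSIAN CORE `G♭ := ({end window} ∖ RgCap) ∩ {|u|² ≤ 1 + x₀²}`, on which the transverse letter `u` is always localized (part (i): `|u| < τ`; parts (ii)/(iii):
`B₀ ≥ 3` resp. `≥ 12τ²`).  This file re-runs the split and the assembly with `G♭`:
* §1 `endCore_letters_subset_core` (`{end window} ∖ RgCap ⊆ G♭ ∪ T`), `measurableSet_endGaussCore`;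
* §2 ★★ `lintegral_endCore_le_gaussCore_add_tail` ∕ `setIntegral_endCore_le_gaussCore_add_tail` ∕ `setIntegral_endCore_chart_le_gaussCore_add_tail` (same tail);
* §3 ★★★ `stub_core_end_of_gaussCore (hG♭) : <stub_core_end VERBATIM>` — `hG♭` = the matched comparison on `G♭` per good `ε`:
  `κ_L·coneConst·π·∫_{G♭} e^{−bF̂(hubAt δ 1,ε,η)} dμ_B ≤ (1/128)·(2π/b)^α·∫_{HubBulk τ}∫𝔪_ε` (the shape to register as `stub_end_gaussCore`; ✓`bulkHub_ge_half_main`,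
  ✓`endTail_le_main`, ✓`endTail_threshold` reused verbatim).

HONEST LABEL: bookkeeping; `stub_core_end` is closed MODULO `hG♭` (OPEN: leader side w3 g67, follower side w2 g60); stubs core-tip ∕ 001-good of ➎ OPEN; ⟨24197⟩ ∕ ⟨24194⟩ OPEN;
own crux ⟨22884⟩ `LargeFieldMassRefinementTail` OPEN (blocked-on ⟨19935⟩); the Yang–Mills mass gap is NOT proved; no summit is proved by a line.  THEOREMS ONLY
(0 `def`, 0 `sorry`), standard axioms; the series' local `ℍ` instances.  LEAD seat ym-line-sfw-p2 g99 (cell ym-idea-1, free hands), `--supports stmt-QuantumFields-24197`.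
References: [cite: Luscher1983, §2]; [folklore].
-/

set_option autoImplicit false
set_option synthInstance.maxSize 1024

noncomputable section

open MeasureTheory Quaternion Set
open scoped Quaternion BigOperators ENNReal
open Literature.MathematicalPhysics.QuantumLattice
open Literature.MathematicalPhysics.QuantumFieldTheory hiding SU2
open Summit.QuantumFields.YangMills.Theorems.SwapTwistDeficit.ToronLog

attribute [local instance] Literature.Analysis.FluidPDE.Tao2016.quatMeasurableSpace
  Literature.Analysis.FluidPDE.Tao2016.quatBorelSpace
  Literature.MathematicalPhysics.QuantumLattice.secondCountableTopology_su2

namespace Summit.QuantumFields.YangMills.Theorems.SwapVirialDeficit.SectorLaplace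

open Summit.QuantumFields.YangMills.Theorems.FemtoTransferGap
open Summit.QuantumFields.YangMills.Theorems.FemtoTransferGap.TT
open Summit.QuantumFields.YangMills.Theorems.VirialFluxGap.RingDeficit
open Summit.QuantumFields.YangMills.Theorems.SwapVirialDeficit.SwapRing
open Summit.QuantumFields.YangMills.Theorems.SwapVirialDeficit.BlowUpRing

variable {L : ℕ} [NeZero L]

/-! ## §1 The Gaussian core `G♭` -/

omit [NeZero L] in
/-- ★ `{end window} ∖ RgCap ⊆ G♭ ∪ T` with the GAUSSIAN CORE `G♭ = ({end window} ∖ RgCap) ∩ {|u|² ≤ 1 + x₀²}` (✓`endCore_letters_subset`, keeping the excision). [folklore] -/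
theorem endCore_letters_subset_core {τ X₁ : ℝ} (hτ : 0 < τ) (hX : 1 ≤ X₁) :
    {p : ℝ × GnoCoord L | 4 * p.1 ^ 2 / (1 + p.1 ^ 2) ^ 2 < τ ∧ τ ≤ (1 + p.1 ^ 2)⁻¹} \
        ({p : ℝ × GnoCoord L | 4 * p.1 ^ 2 / (1 + p.1 ^ 2) ^ 2 < τ ∧ τ ≤ (1 + p.1 ^ 2)⁻¹ ∧ |p.1| < τ * Real.sqrt (1 + p.1 ^ 2)} ∩
          {p : ℝ × GnoCoord L | τ ≤ Real.sqrt (p.2.1.1 1 ^ 2 + p.2.1.1 2 ^ 2)} ∩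
          {p : ℝ × GnoCoord L | |p.2.1.1 0| ≤ X₁ * Real.sqrt (1 + p.2.1.1 1 ^ 2 + p.2.1.1 2 ^ 2)}) ⊆
      ({p : ℝ × GnoCoord L | 4 * p.1 ^ 2 / (1 + p.1 ^ 2) ^ 2 < τ ∧ τ ≤ (1 + p.1 ^ 2)⁻¹} \
          ({p : ℝ × GnoCoord L | 4 * p.1 ^ 2 / (1 + p.1 ^ 2) ^ 2 < τ ∧ τ ≤ (1 + p.1 ^ 2)⁻¹ ∧ |p.1| < τ * Real.sqrt (1 + p.1 ^ 2)} ∩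
            {p : ℝ × GnoCoord L | τ ≤ Real.sqrt (p.2.1.1 1 ^ 2 + p.2.1.1 2 ^ 2)} ∩
            {p : ℝ × GnoCoord L | |p.2.1.1 0| ≤ X₁ * Real.sqrt (1 + p.2.1.1 1 ^ 2 + p.2.1.1 2 ^ 2)}) ∩
          {p : ℝ × GnoCoord L | p.2.1.1 1 ^ 2 + p.2.1.1 2 ^ 2 ≤ 1 + p.2.1.1 0 ^ 2}) ∪
        ({p : ℝ × GnoCoord L | (4 * p.1 ^ 2 / (1 + p.1 ^ 2) ^ 2 < τ ∧ τ ≤ (1 + p.1 ^ 2)⁻¹) ∧ τ * Real.sqrt (1 + p.1 ^ 2) ≤ |p.1|} ∩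
          {p : ℝ × GnoCoord L | τ ≤ Real.sqrt (p.2.1.1 1 ^ 2 + p.2.1.1 2 ^ 2)} ∩
          {p : ℝ × GnoCoord L | |p.2.1.1 0| ≤ X₁ * Real.sqrt (1 + p.2.1.1 1 ^ 2 + p.2.1.1 2 ^ 2)}) := by
  intro p hp
  rcases endCore_letters_subset (L := L) hτ hX hp with hG | hT
  · exact Or.inl ⟨hp, hG.2⟩
  · exact Or.inr hT

omit [NeZero L] in
/-- `G♭` is measurable. [folklore] -/
theorem measurableSet_endGaussCore (τ X₁ : ℝ) :
    MeasurableSet ({p : ℝ × GnoCoord L | 4 * p.1 ^ 2 / (1 + p.1 ^ 2) ^ 2 < τ ∧ τ ≤ (1 + p.1 ^ 2)⁻¹} \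
          ({p : ℝ × GnoCoord L | 4 * p.1 ^ 2 / (1 + p.1 ^ 2) ^ 2 < τ ∧ τ ≤ (1 + p.1 ^ 2)⁻¹ ∧ |p.1| < τ * Real.sqrt (1 + p.1 ^ 2)} ∩
            {p : ℝ × GnoCoord L | τ ≤ Real.sqrt (p.2.1.1 1 ^ 2 + p.2.1.1 2 ^ 2)} ∩
            {p : ℝ × GnoCoord L | |p.2.1.1 0| ≤ X₁ * Real.sqrt (1 + p.2.1.1 1 ^ 2 + p.2.1.1 2 ^ 2)}) ∩
          {p : ℝ × GnoCoord L | p.2.1.1 1 ^ 2 + p.2.1.1 2 ^ 2 ≤ 1 + p.2.1.1 0 ^ 2}) := by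
  have hx : ∀ i : Fin 3, Measurable fun p : ℝ × GnoCoord L => p.2.1.1 i :=
    fun i => (measurable_pi_apply i).comp (measurable_fst.comp (measurable_fst.comp measurable_snd))
  exact ((measurableSet_endWindow τ).diff (measurableSet_bCapRegion τ X₁)).inter
    (measurableSet_le (((hx 1).pow_const 2).add ((hx 2).pow_const 2)) (measurable_const.add ((hx 0).pow_const 2)))

/-! ## §2 The end core ≤ Gaussian core + tail -/

/-- ★★ **THE END CORE ≤ GAUSSIAN CORE + TAIL** (letters, `ℝ≥0∞` form): for `0 < τ`, `1 ≤ X₁`, `0 ≤ b`,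
`∫⁻_{{end window}∖RgCap} ofReal(e^{−bF̂}) dμ_B ≤ ∫⁻_{G♭} ofReal(e^{−bF̂}) dμ_B + ofReal(e^{−b·c_end}·π·e^{|log(coneConst³/64)|+18L⁴})`. [folklore] -/
theorem lintegral_endCore_le_gaussCore_add_tail (ε : GnoSign L) {τ X₁ b : ℝ} (hτ : 0 < τ) (hX : 1 ≤ X₁) (hb : 0 ≤ b) :
    ∫⁻ p in {p : ℝ × GnoCoord L | 4 * p.1 ^ 2 / (1 + p.1 ^ 2) ^ 2 < τ ∧ τ ≤ (1 + p.1 ^ 2)⁻¹} \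
            ({p : ℝ × GnoCoord L | 4 * p.1 ^ 2 / (1 + p.1 ^ 2) ^ 2 < τ ∧ τ ≤ (1 + p.1 ^ 2)⁻¹ ∧ |p.1| < τ * Real.sqrt (1 + p.1 ^ 2)} ∩
              {p : ℝ × GnoCoord L | τ ≤ Real.sqrt (p.2.1.1 1 ^ 2 + p.2.1.1 2 ^ 2)} ∩
              {p : ℝ × GnoCoord L | |p.2.1.1 0| ≤ X₁ * Real.sqrt (1 + p.2.1.1 1 ^ 2 + p.2.1.1 2 ^ 2)}),
          ENNReal.ofReal (Real.exp (-(b * gnoDeficit z₀ (fun _ => 1) (hubAt p.1 1) ε p.2)))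
          ∂((volume : Measure (ℝ × GnoCoord L)).withDensity fun p => ENNReal.ofReal (((1 + p.1 ^ 2)⁻¹) ^ 2 * gnoDensity p.2)) ≤
      (∫⁻ p in {p : ℝ × GnoCoord L | 4 * p.1 ^ 2 / (1 + p.1 ^ 2) ^ 2 < τ ∧ τ ≤ (1 + p.1 ^ 2)⁻¹} \
              ({p : ℝ × GnoCoord L | 4 * p.1 ^ 2 / (1 + p.1 ^ 2) ^ 2 < τ ∧ τ ≤ (1 + p.1 ^ 2)⁻¹ ∧ |p.1| < τ * Real.sqrt (1 + p.1 ^ 2)} ∩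
                {p : ℝ × GnoCoord L | τ ≤ Real.sqrt (p.2.1.1 1 ^ 2 + p.2.1.1 2 ^ 2)} ∩
                {p : ℝ × GnoCoord L | |p.2.1.1 0| ≤ X₁ * Real.sqrt (1 + p.2.1.1 1 ^ 2 + p.2.1.1 2 ^ 2)}) ∩
              {p : ℝ × GnoCoord L | p.2.1.1 1 ^ 2 + p.2.1.1 2 ^ 2 ≤ 1 + p.2.1.1 0 ^ 2},
          ENNReal.ofReal (Real.exp (-(b * gnoDeficit z₀ (fun _ => 1) (hubAt p.1 1) ε p.2)))
          ∂((volume : Measure (ℝ × GnoCoord L)).withDensity fun p => ENNReal.ofReal (((1 + p.1 ^ 2)⁻¹) ^ 2 * gnoDensity p.2))) +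
        ENNReal.ofReal (Real.exp (-(b * (τ ^ 4 / ((1 + τ ^ 2) * (1 + X₁ ^ 2) ^ 2 * (15000 * (1 + (Fintype.card (Fol L) : ℝ)) * (L : ℝ) ^ 6))))) *
          (Real.pi * Real.exp (|Real.log (coneConst ^ 3 / 64)| + 18 * (L : ℝ) ^ 4))) := by
  have hsub := endCore_letters_subset_core (L := L) hτ hX
  refine (lintegral_mono_set hsub).trans ((lintegral_union_le _ _ _).trans ?_)
  exact add_le_add le_rfl (lintegral_endHubShell_le ε X₁ hτ hb)

/-- ★★ **THE END CORE ≤ GAUSSIAN CORE + TAIL** (letters, Bochner form). [folklore] -/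
theorem setIntegral_endCore_le_gaussCore_add_tail (ε : GnoSign L) {τ X₁ b : ℝ} (hτ : 0 < τ) (hX : 1 ≤ X₁) (hb : 0 ≤ b) :
    ∫ p in {p : ℝ × GnoCoord L | 4 * p.1 ^ 2 / (1 + p.1 ^ 2) ^ 2 < τ ∧ τ ≤ (1 + p.1 ^ 2)⁻¹} \
            ({p : ℝ × GnoCoord L | 4 * p.1 ^ 2 / (1 + p.1 ^ 2) ^ 2 < τ ∧ τ ≤ (1 + p.1 ^ 2)⁻¹ ∧ |p.1| < τ * Real.sqrt (1 + p.1 ^ 2)} ∩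
              {p : ℝ × GnoCoord L | τ ≤ Real.sqrt (p.2.1.1 1 ^ 2 + p.2.1.1 2 ^ 2)} ∩
              {p : ℝ × GnoCoord L | |p.2.1.1 0| ≤ X₁ * Real.sqrt (1 + p.2.1.1 1 ^ 2 + p.2.1.1 2 ^ 2)}),
          Real.exp (-(b * gnoDeficit z₀ (fun _ => 1) (hubAt p.1 1) ε p.2))
          ∂((volume : Measure (ℝ × GnoCoord L)).withDensity fun p => ENNReal.ofReal (((1 + p.1 ^ 2)⁻¹) ^ 2 * gnoDensity p.2)) ≤
      (∫ p in {p : ℝ × GnoCoord L | 4 * p.1 ^ 2 / (1 + p.1 ^ 2) ^ 2 < τ ∧ τ ≤ (1 + p.1 ^ 2)⁻¹} \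
              ({p : ℝ × GnoCoord L | 4 * p.1 ^ 2 / (1 + p.1 ^ 2) ^ 2 < τ ∧ τ ≤ (1 + p.1 ^ 2)⁻¹ ∧ |p.1| < τ * Real.sqrt (1 + p.1 ^ 2)} ∩
                {p : ℝ × GnoCoord L | τ ≤ Real.sqrt (p.2.1.1 1 ^ 2 + p.2.1.1 2 ^ 2)} ∩
                {p : ℝ × GnoCoord L | |p.2.1.1 0| ≤ X₁ * Real.sqrt (1 + p.2.1.1 1 ^ 2 + p.2.1.1 2 ^ 2)}) ∩
              {p : ℝ × GnoCoord L | p.2.1.1 1 ^ 2 + p.2.1.1 2 ^ 2 ≤ 1 + p.2.1.1 0 ^ 2},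
          Real.exp (-(b * gnoDeficit z₀ (fun _ => 1) (hubAt p.1 1) ε p.2))
          ∂((volume : Measure (ℝ × GnoCoord L)).withDensity fun p => ENNReal.ofReal (((1 + p.1 ^ 2)⁻¹) ^ 2 * gnoDensity p.2))) +
        Real.exp (-(b * (τ ^ 4 / ((1 + τ ^ 2) * (1 + X₁ ^ 2) ^ 2 * (15000 * (1 + (Fintype.card (Fol L) : ℝ)) * (L : ℝ) ^ 6))))) *
          (Real.pi * Real.exp (|Real.log (coneConst ^ 3 / 64)| + 18 * (L : ℝ) ^ 4)) := by
  set μB := (volume : Measure (ℝ × GnoCoord L)).withDensity fun p => ENNReal.ofReal (((1 + p.1 ^ 2)⁻¹) ^ 2 * gnoDensity p.2) with hμB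
  haveI : IsFiniteMeasure μB := isFiniteMeasure_muB
  set f : ℝ × GnoCoord L → ℝ := fun p => Real.exp (-(b * gnoDeficit z₀ (fun _ => 1) (hubAt p.1 1) ε p.2)) with hf
  have hfm : Measurable f := ((measurable_bDeficit z₀ (fun _ => 1) ε).const_mul b).neg.exp
  have hf0 : ∀ p, 0 ≤ f p := fun p => (Real.exp_pos _).le
  have hf1 : ∀ p, f p ≤ 1 := fun p => by
    show Real.exp _ ≤ 1
    rw [Real.exp_le_one_iff, neg_nonpos]
    exact mul_nonneg hb (gnoDeficit_nonneg _ _ _ _ _)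
  have hfi : ∀ S : Set (ℝ × GnoCoord L), IntegrableOn f S μB := fun S =>
    ((integrable_const (1 : ℝ)).mono' hfm.aestronglyMeasurable
      (Filter.Eventually.of_forall fun p => by rw [Real.norm_eq_abs, abs_of_nonneg (hf0 p)]; exact hf1 p)).integrableOn
  set EW : Set (ℝ × GnoCoord L) := {p : ℝ × GnoCoord L | 4 * p.1 ^ 2 / (1 + p.1 ^ 2) ^ 2 < τ ∧ τ ≤ (1 + p.1 ^ 2)⁻¹} with hEW
  set RC : Set (ℝ × GnoCoord L) :=
    {p : ℝ × GnoCoord L | 4 * p.1 ^ 2 / (1 + p.1 ^ 2) ^ 2 < τ ∧ τ ≤ (1 + p.1 ^ 2)⁻¹ ∧ |p.1| < τ * Real.sqrt (1 + p.1 ^ 2)} ∩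
      {p : ℝ × GnoCoord L | τ ≤ Real.sqrt (p.2.1.1 1 ^ 2 + p.2.1.1 2 ^ 2)} ∩
      {p : ℝ × GnoCoord L | |p.2.1.1 0| ≤ X₁ * Real.sqrt (1 + p.2.1.1 1 ^ 2 + p.2.1.1 2 ^ 2)} with hRC
  set G : Set (ℝ × GnoCoord L) := (EW \ RC) ∩ {p : ℝ × GnoCoord L | p.2.1.1 1 ^ 2 + p.2.1.1 2 ^ 2 ≤ 1 + p.2.1.1 0 ^ 2} with hG
  have hGm : MeasurableSet G := measurableSet_endGaussCore τ X₁
  set K : ℝ := Real.exp (-(b * (τ ^ 4 / ((1 + τ ^ 2) * (1 + X₁ ^ 2) ^ 2 * (15000 * (1 + (Fintype.card (Fol L) : ℝ)) * (L : ℝ) ^ 6))))) *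
    (Real.pi * Real.exp (|Real.log (coneConst ^ 3 / 64)| + 18 * (L : ℝ) ^ 4)) with hK
  have hK0 : 0 ≤ K := by positivity
  have h := lintegral_endCore_le_gaussCore_add_tail ε hτ hX hb
  rw [← hμB] at h
  have e1 : ∫⁻ p in EW \ RC, ENNReal.ofReal (f p) ∂μB = ENNReal.ofReal (∫ p in EW \ RC, f p ∂μB) :=
    (ofReal_integral_eq_lintegral_ofReal (hfi _) (Filter.Eventually.of_forall hf0)).symm
  have e2 : ∫⁻ p in G, ENNReal.ofReal (f p) ∂μB = ENNReal.ofReal (∫ p in G, f p ∂μB) :=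
    (ofReal_integral_eq_lintegral_ofReal (hfi _) (Filter.Eventually.of_forall hf0)).symm
  have h' : ENNReal.ofReal (∫ p in EW \ RC, f p ∂μB) ≤ ENNReal.ofReal (∫ p in G, f p ∂μB) + ENNReal.ofReal K := by
    have h'' := h
    rw [e1, e2] at h''
    exact h''
  rw [← ENNReal.ofReal_add (setIntegral_nonneg hGm fun p _ => hf0 p) hK0] at h'
  exact (ENNReal.ofReal_le_ofReal_iff (add_nonneg (setIntegral_nonneg hGm fun p _ => hf0 p) hK0)).1 h'

/-- ★★ **THE END CORE OF SKELETON ➎ ≤ GAUSSIAN CORE + TAIL, READ ON `chartMeasure L`** (`X₁ = 1`): for `0 < τ`, `0 ≤ b` and every sign pattern `ε`,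
`∫_{(EndHub τ ×ˢ univ) ∖ BTubeCap L τ 1} e^{−bF̂_ε} d(chartMeasure) ≤ coneConst·π·(∫_{G♭} e^{−bF̂(hubAt δ 1, ε, η)} dμ_B + e^{−b·c_end(τ,1)}·π·e^{|log(coneConst³/64)|+18L⁴})`. [folklore] -/
theorem setIntegral_endCore_chart_le_gaussCore_add_tail (ε : GnoSign L) {τ b : ℝ} (hτ : 0 < τ) (hb : 0 ≤ b) :
    ∫ x in (EndHub τ ×ˢ (univ : Set (GnoCoord L))) \ BTubeCap L τ 1, Real.exp (-(b * gnoDeficit z₀ (fun _ => 1) x.1 ε x.2)) ∂(chartMeasure L) ≤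
      coneConst * Real.pi *
        ((∫ p in {p : ℝ × GnoCoord L | 4 * p.1 ^ 2 / (1 + p.1 ^ 2) ^ 2 < τ ∧ τ ≤ (1 + p.1 ^ 2)⁻¹} \
                ({p : ℝ × GnoCoord L | 4 * p.1 ^ 2 / (1 + p.1 ^ 2) ^ 2 < τ ∧ τ ≤ (1 + p.1 ^ 2)⁻¹ ∧ |p.1| < τ * Real.sqrt (1 + p.1 ^ 2)} ∩
                  {p : ℝ × GnoCoord L | τ ≤ Real.sqrt (p.2.1.1 1 ^ 2 + p.2.1.1 2 ^ 2)} ∩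
                  {p : ℝ × GnoCoord L | |p.2.1.1 0| ≤ 1 * Real.sqrt (1 + p.2.1.1 1 ^ 2 + p.2.1.1 2 ^ 2)}) ∩
                {p : ℝ × GnoCoord L | p.2.1.1 1 ^ 2 + p.2.1.1 2 ^ 2 ≤ 1 + p.2.1.1 0 ^ 2},
            Real.exp (-(b * gnoDeficit z₀ (fun _ => 1) (hubAt p.1 1) ε p.2))
            ∂((volume : Measure (ℝ × GnoCoord L)).withDensity fun p => ENNReal.ofReal (((1 + p.1 ^ 2)⁻¹) ^ 2 * gnoDensity p.2))) +
          Real.exp (-(b * (τ ^ 4 / ((1 + τ ^ 2) * (1 + (1 : ℝ) ^ 2) ^ 2 * (15000 * (1 + (Fintype.card (Fol L) : ℝ)) * (L : ℝ) ^ 6))))) *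
            (Real.pi * Real.exp (|Real.log (coneConst ^ 3 / 64)| + 18 * (L : ℝ) ^ 4))) := by
  rw [setIntegral_endCore_exp_eq_hubCot z₀ (fun _ => 1) ε τ 1 b]
  exact mul_le_mul_of_nonneg_left (setIntegral_endCore_le_gaussCore_add_tail ε hτ le_rfl hb) (mul_pos coneConst_pos Real.pi_pos).le

/-! ## §3 ★★★ `stub_core_end` from the matched comparison on the Gaussian core -/

set_option maxHeartbeats 800000 in
/-- ★★★ **`stub_core_end` OF SKELETON ➎ (v8 = v9 = v10 statement) VERBATIM, FROM THE MATCHED COMPARISON ON THE GAUSSIAN CORE `hG♭`**: if for every `L`,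
every cut `0 < τ ≤ τ₀/L^k`, every `b ≥ K·L^k·τ⁻¹^k` and every good sign pattern `ε`
`κ_L·coneConst·π·∫_{G♭} e^{−bF̂(hubAt δ 1, ε, η)} dμ_B ≤ (1/128)·(2π/b)^α·∫_{HubBulk τ}∫_{ℝ²}𝔪_ε` (`G♭ = ({end window} ∖ RgCap(τ,1)) ∩ {|u|² ≤ 1 + x₀²}`), then the
END core weighs at most `1/32` of the good bulk mass above a merged threshold (✓`bulkHub_ge_half_main`, ✓`endTail_le_main`, ✓`endTail_threshold`; the proof of
✓`stub_core_end_of_gaussHalf` with `G♭` in place of `G`). [cite: Luscher1983, §2] -/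
theorem stub_core_end_of_gaussCore
    (hG : ∃ K : ℝ, 0 < K ∧ ∃ k : ℕ, ∃ τ₀ : ℝ, 0 < τ₀ ∧ τ₀ ≤ 1 / 2 ∧ ∀ (L : ℕ) [NeZero L] (τ : ℝ), 0 < τ → τ ≤ τ₀ / (L : ℝ) ^ k →
      ∀ b : ℝ, K * (L : ℝ) ^ k * τ⁻¹ ^ k ≤ b → ∀ ε : GnoSign L, GoodSign ε →
        stiffKappa L (1 / 8) * (coneConst * Real.pi *
          ∫ p in {p : ℝ × GnoCoord L | 4 * p.1 ^ 2 / (1 + p.1 ^ 2) ^ 2 < τ ∧ τ ≤ (1 + p.1 ^ 2)⁻¹} \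
                  ({p : ℝ × GnoCoord L | 4 * p.1 ^ 2 / (1 + p.1 ^ 2) ^ 2 < τ ∧ τ ≤ (1 + p.1 ^ 2)⁻¹ ∧ |p.1| < τ * Real.sqrt (1 + p.1 ^ 2)} ∩
                    {p : ℝ × GnoCoord L | τ ≤ Real.sqrt (p.2.1.1 1 ^ 2 + p.2.1.1 2 ^ 2)} ∩
                    {p : ℝ × GnoCoord L | |p.2.1.1 0| ≤ 1 * Real.sqrt (1 + p.2.1.1 1 ^ 2 + p.2.1.1 2 ^ 2)}) ∩
                  {p : ℝ × GnoCoord L | p.2.1.1 1 ^ 2 + p.2.1.1 2 ^ 2 ≤ 1 + p.2.1.1 0 ^ 2},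
              Real.exp (-(b * gnoDeficit z₀ (fun _ => 1) (hubAt p.1 1) ε p.2))
              ∂((volume : Measure (ℝ × GnoCoord L)).withDensity fun p => ENNReal.ofReal (((1 + p.1 ^ 2)⁻¹) ^ 2 * gnoDensity p.2))) ≤
          (1 / 128 : ℝ) * ((2 * Real.pi / b) ^ alpha L * ∫ a in HubBulk τ, (∫ p : ℝ × ℝ, mbDensity a ε p) ∂coneMeasure)) :
    ∃ K : ℝ, 0 < K ∧ ∃ k : ℕ, ∃ τ₀ : ℝ, 0 < τ₀ ∧ τ₀ ≤ 1 / 2 ∧ ∀ (L : ℕ) [NeZero L] (τ : ℝ), 0 < τ → τ ≤ τ₀ / (L : ℝ) ^ k →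
      ∀ b : ℝ, K * (L : ℝ) ^ k * τ⁻¹ ^ k ≤ b →
        stiffKappa L (1 / 8) * ∑ ε ∈ (Finset.univ.filter fun ε : GnoSign L => GoodSign ε),
            ∫ x in (EndHub τ ×ˢ (univ : Set (GnoCoord L))) \ BTubeCap L τ 1, Real.exp (-(b * gnoDeficit z₀ (fun _ => 1) x.1 ε x.2)) ∂chartMeasure L ≤
          (1 / 32 : ℝ) * ∑ ε ∈ (Finset.univ.filter fun ε : GnoSign L => GoodSign ε), ∫ a in HubBulk τ, hubIntegral a ε b ∂coneMeasure := by
  obtain ⟨K₂, hK₂, k₂, hS2⟩ := bulk_fibred_plane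
  obtain ⟨KG, hKG, kG, τG, hτG, hτGh, hGf⟩ := hG
  -- the absolute constants
  set A₀ : ℝ := |Real.log (coneMeasure.real (HubBulk (1 / 2)))| + |Real.log (coneConst ^ 3 / 64)| with hA₀
  set D₀ : ℝ := 40000 * (K₂ + 1) ^ (k₂ + 1) * (A₀ + 183620 + 40) with hD₀
  set dB : ℕ := 20 + k₂ + k₂ * k₂ with hdB
  set AT : ℝ := |Real.log (coneMeasure.real (HubBulk (1 / 2)))| + 2 * |Real.log (coneConst ^ 3 / 64)| + 154 + 183669 with hAT
  set KT : ℝ := (840000 * AT) ^ 2 with hKT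
  have hD₀0 : 0 < D₀ := by rw [hD₀, hA₀]; positivity
  have hAT40 : 40 ≤ AT := by
    rw [hAT]
    have h1 := abs_nonneg (Real.log (coneMeasure.real (HubBulk (1 / 2))))
    have h2 := abs_nonneg (Real.log (coneConst ^ 3 / 64))
    linarith
  have hKT0 : 0 < KT := by rw [hKT]; exact pow_pos (mul_pos (by norm_num) (by linarith)) 2
  have hKsum0 : 0 < KG + D₀ ^ 4 + KT := add_pos_of_pos_of_nonneg (add_pos_of_pos_of_nonneg hKG (pow_nonneg hD₀0.le 4)) hKT0.le
  refine ⟨KG + D₀ ^ 4 + KT, hKsum0, kG + 4 * dB + 36, τG, hτG, hτGh, fun L _ τ hτ hτle b hb => ?_⟩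
  have hL1 : (1 : ℝ) ≤ L := by exact_mod_cast NeZero.one_le
  have hL0 : (0 : ℝ) < L := by linarith
  set k : ℕ := kG + 4 * dB + 36 with hk
  have hLk : (1 : ℝ) ≤ (L : ℝ) ^ k := one_le_pow₀ hL1
  have hτ1 : τ ≤ 1 / 2 := hτle.trans ((div_le_self hτG.le hLk).trans hτGh)
  have hτi1 : 1 ≤ τ⁻¹ := by rw [one_le_inv₀ hτ]; linarith
  have hτleG : τ ≤ τG / (L : ℝ) ^ kG :=
    hτle.trans (div_le_div₀ hτG.le le_rfl (by positivity) (pow_le_pow_right₀ hL1 (by omega)))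
  -- the three thresholds
  have hmono : ∀ {K' : ℝ} {k' : ℕ}, 0 < K' → K' ≤ KG + D₀ ^ 4 + KT → k' ≤ k → K' * (L : ℝ) ^ k' * τ⁻¹ ^ k' ≤ b := by
    intro K' k' hK' hK'le hk'
    have h1 : τ⁻¹ ^ k' ≤ τ⁻¹ ^ k := pow_le_pow_right₀ hτi1 hk'
    have h3 : (L : ℝ) ^ k' ≤ (L : ℝ) ^ k := pow_le_pow_right₀ hL1 hk'
    calc K' * (L : ℝ) ^ k' * τ⁻¹ ^ k' ≤ (KG + D₀ ^ 4 + KT) * (L : ℝ) ^ k * τ⁻¹ ^ k :=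
          mul_le_mul (mul_le_mul hK'le h3 (by positivity) hKsum0.le) h1 (by positivity) (mul_nonneg hKsum0.le (by positivity))
      _ ≤ b := hb
  have hD4 : 0 < D₀ ^ 4 := pow_pos hD₀0 4
  have hbG : KG * (L : ℝ) ^ kG * τ⁻¹ ^ kG ≤ b := hmono hKG (by linarith) (by omega)
  have hbT : KT * (L : ℝ) ^ 36 * τ⁻¹ ^ 36 ≤ b := hmono hKT0 (by linarith) (by omega)
  have hbB' : D₀ ^ 4 * (L : ℝ) ^ (4 * dB) * τ⁻¹ ^ (4 * dB) ≤ b := hmono hD4 (by linarith) (by omega)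
  have hbB : (40000 * (K₂ + 1) ^ (k₂ + 1) *
      ((|Real.log (coneMeasure.real (HubBulk (1 / 2)))| + |Real.log (coneConst ^ 3 / 64)| + 183620 * (L : ℝ) ^ 8) + 40) *
        (L : ℝ) ^ (12 + k₂ + k₂ * k₂) * τ⁻¹ ^ k₂) ^ 4 ≤ b := by
    refine le_trans ?_ hbB'
    have h1 : 40000 * (K₂ + 1) ^ (k₂ + 1) *
        ((|Real.log (coneMeasure.real (HubBulk (1 / 2)))| + |Real.log (coneConst ^ 3 / 64)| + 183620 * (L : ℝ) ^ 8) + 40) *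
          (L : ℝ) ^ (12 + k₂ + k₂ * k₂) * τ⁻¹ ^ k₂ ≤ D₀ * (L : ℝ) ^ dB * τ⁻¹ ^ dB := by
      have hL8 : (1 : ℝ) ≤ (L : ℝ) ^ 8 := one_le_pow₀ hL1
      have hin : (|Real.log (coneMeasure.real (HubBulk (1 / 2)))| + |Real.log (coneConst ^ 3 / 64)| + 183620 * (L : ℝ) ^ 8) + 40 ≤
          (A₀ + 183620 + 40) * (L : ℝ) ^ 8 := by
        rw [hA₀]; nlinarith [abs_nonneg (Real.log (coneMeasure.real (HubBulk (1 / 2)))), abs_nonneg (Real.log (coneConst ^ 3 / 64))]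
      calc 40000 * (K₂ + 1) ^ (k₂ + 1) *
            ((|Real.log (coneMeasure.real (HubBulk (1 / 2)))| + |Real.log (coneConst ^ 3 / 64)| + 183620 * (L : ℝ) ^ 8) + 40) *
              (L : ℝ) ^ (12 + k₂ + k₂ * k₂) * τ⁻¹ ^ k₂
          ≤ 40000 * (K₂ + 1) ^ (k₂ + 1) * ((A₀ + 183620 + 40) * (L : ℝ) ^ 8) * (L : ℝ) ^ (12 + k₂ + k₂ * k₂) * τ⁻¹ ^ dB := by
            refine mul_le_mul (mul_le_mul_of_nonneg_right (mul_le_mul_of_nonneg_left hin (by positivity)) (by positivity))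
              (pow_le_pow_right₀ hτi1 (by omega)) (by positivity) (by positivity)
        _ = D₀ * (L : ℝ) ^ dB * τ⁻¹ ^ dB := by rw [hD₀, hdB]; ring
    have h0 : 0 ≤ 40000 * (K₂ + 1) ^ (k₂ + 1) *
        ((|Real.log (coneMeasure.real (HubBulk (1 / 2)))| + |Real.log (coneConst ^ 3 / 64)| + 183620 * (L : ℝ) ^ 8) + 40) *
          (L : ℝ) ^ (12 + k₂ + k₂ * k₂) * τ⁻¹ ^ k₂ := by positivity
    calc _ ≤ (D₀ * (L : ℝ) ^ dB * τ⁻¹ ^ dB) ^ 4 := pow_le_pow_left₀ h0 h1 4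
      _ = D₀ ^ 4 * (L : ℝ) ^ (4 * dB) * τ⁻¹ ^ (4 * dB) := by rw [mul_pow, mul_pow, ← pow_mul, ← pow_mul, mul_comm dB 4]
  -- the tail threshold
  obtain ⟨hb1, hXT⟩ := endTail_threshold (L := L) hτ hτ1 hAT40 hbT
  have hb0 : 0 ≤ b := by linarith
  have hq0 : 0 ≤ b ^ (1 / 4 : ℝ) := Real.rpow_nonneg hb0 _
  have hX : b ^ (1 / 4 : ℝ) * (4 * (9 * (L : ℝ) ^ 4 + 1) +
      (|Real.log (coneMeasure.real (HubBulk (1 / 2)))| + 2 * |Real.log (coneConst ^ 3 / 64)| + 154 + 183629 * (L : ℝ) ^ 8)) ≤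
      b * (τ ^ 4 / ((1 + τ ^ 2) * (1 + (1 : ℝ) ^ 2) ^ 2 * (15000 * (1 + (Fintype.card (Fol L) : ℝ)) * (L : ℝ) ^ 6))) :=
    (mul_le_mul_of_nonneg_left (endTail_const_le (L := L) hL1) hq0).trans (by rw [← hAT]; exact hXT)
  have hκ : 0 ≤ stiffKappa L (1 / 8) := (stiffKappa_pos_le_exp (L := L)).1.le
  -- per sign pattern
  have hper : ∀ ε ∈ (Finset.univ.filter fun ε : GnoSign L => GoodSign ε),
      stiffKappa L (1 / 8) *
          ∫ x in (EndHub τ ×ˢ (univ : Set (GnoCoord L))) \ BTubeCap L τ 1, Real.exp (-(b * gnoDeficit z₀ (fun _ => 1) x.1 ε x.2)) ∂chartMeasure L ≤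
        (1 / 32 : ℝ) * ∫ a in HubBulk τ, hubIntegral a ε b ∂coneMeasure := by
    intro ε hεm
    have hε : GoodSign ε := (Finset.mem_filter.1 hεm).2
    have hsplit := mul_le_mul_of_nonneg_left (setIntegral_endCore_chart_le_gaussCore_add_tail ε hτ hb0) hκ
    have hGε := hGf L τ hτ hτleG b hbG ε hε
    have hT := endTail_le_main (L := L) hε hτ hτ1 hb1 hX
    have hZ := bulkHub_ge_half_main hK₂ (hS2 L) hε hτ hτ1 hbB
    rw [mul_add, mul_add] at hsplit
    linarith
  calc stiffKappa L (1 / 8) * ∑ ε ∈ (Finset.univ.filter fun ε : GnoSign L => GoodSign ε),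
        ∫ x in (EndHub τ ×ˢ (univ : Set (GnoCoord L))) \ BTubeCap L τ 1, Real.exp (-(b * gnoDeficit z₀ (fun _ => 1) x.1 ε x.2)) ∂chartMeasure L
      = ∑ ε ∈ (Finset.univ.filter fun ε : GnoSign L => GoodSign ε), stiffKappa L (1 / 8) *
          ∫ x in (EndHub τ ×ˢ (univ : Set (GnoCoord L))) \ BTubeCap L τ 1, Real.exp (-(b * gnoDeficit z₀ (fun _ => 1) x.1 ε x.2)) ∂chartMeasure L :=
        Finset.mul_sum _ _ _
    _ ≤ ∑ ε ∈ (Finset.univ.filter fun ε : GnoSign L => GoodSign ε), (1 / 32 : ℝ) * ∫ a in HubBulk τ, hubIntegral a ε b ∂coneMeasure :=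
        Finset.sum_le_sum hper
    _ = _ := (Finset.mul_sum _ _ _).symm

end Summit.QuantumFields.YangMills.Theorems.SwapVirialDeficit.SectorLaplace

end
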